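import Summits.SmoothPoincare4.SmoothPoincare4.Theses.SullivanDual
import Summits.SmoothPoincare4.SmoothPoincare4.Theorems.SullivanDualGromovChartForm
import HarnessLib

/-!
# SmoothPoincare4 / SullivanDual — the support item `GromovChartFormOfRecognition`
(stmt-SmoothPoincare4-15196)

The route item
`Summit.SmoothPoincare4.SmoothPoincare4.Theses.SullivanDual.GromovChartFormOfRecognition` is the
glue implication `GromovRecognitionRelEnd → GromovChartForm`: the promoted crux
`GromovRecognitionRelEnd` (stmt-SmoothPoincare4-11009; Gromov's recognition of `(ℝ⁴, ω₀)` relative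
at infinity, verbatim the Literature statement
`Literature.Geometry.Symplectic.gromov_recognitionR4_relEnd`, McDuff–Salamon 2017 Rem. 4.5.2 (viii))
implies the support item `GromovChartForm` (stmt-SmoothPoincare4-11129; the Gromov–McDuff chart form
for punctured homotopy 4-spheres, verbatim `Literature.Geometry.Symplectic.GromovMcDuffChartForm`).

Both route decls are `δ`-equal to their Literature counterparts, so the item is closed by the
accepted theorem
`Summit.SmoothPoincare4.SmoothPoincare4.Theorems.gromovChartForm_of_recognitionR4_relEnd`
(Theorems/SullivanDualGromovChartForm.lean), itself a transport of
`Literature.Geometry.Symplectic.gromovMcDuffChartForm_of_recognitionR4_relEnd` (the topological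
hypotheses "`Σ ∖ {p}` path connected, `π₂ = 0`" are proved there by general position).

## References

* D. McDuff, D. Salamon, *Introduction to Symplectic Topology*, 3rd ed., OUP 2017,
  Remark 4.5.2 (viii) [McDuffSalamon2017].
* M. Gromov, *Pseudo holomorphic curves in symplectic manifolds*, Invent. Math. 82 (1985),
  §0.3.C [Gromov1985]; D. McDuff, J. AMS 3 (1990), Thm. 1.7 [McDuff1990].
-/

open scoped Manifold ContDiff

-- the prescribed namespace `Summit.<P>.<Sub>.…` duplicates `SmoothPoincare4` (P = Sub)
set_option linter.dupNamespace false

namespace Summit.SmoothPoincare4.SmoothPoincare4.Theorems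

open Summit.SmoothPoincare4.SmoothPoincare4.Theses.SullivanDual

/-- The route decl `GromovRecognitionRelEnd` (crux stmt-SmoothPoincare4-11009) is, definitionally,
the Literature named fact `Literature.Geometry.Symplectic.gromov_recognitionR4_relEnd`
(McDuff–Salamon 2017, Rem. 4.5.2 (viii)). [folklore] -/
theorem gromovRecognitionRelEnd_iff_gromov_recognitionR4_relEnd :
    GromovRecognitionRelEnd ↔ Literature.Geometry.Symplectic.gromov_recognitionR4_relEnd :=
  Iff.rfl

/-- **Item stmt-SmoothPoincare4-15196 (`GromovChartFormOfRecognition`), proved.** Gromov's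
recognition of `(ℝ⁴, ω₀)` relative at infinity (`GromovRecognitionRelEnd`) implies the
Gromov–McDuff chart form for punctured homotopy 4-spheres (`GromovChartForm`): transport of the
accepted `gromovChartForm_of_recognitionR4_relEnd` along the definitional equality
`gromovRecognitionRelEnd_iff_gromov_recognitionR4_relEnd`.
[cite: McDuffSalamon2017, Rem. 4.5.2 (viii)] -/
theorem gromovChartFormOfRecognition_proof : GromovChartFormOfRecognition := by
  unfold GromovChartFormOfRecognition
  intro hGR
  exact gromovChartForm_of_recognitionR4_relEnd
    (gromovRecognitionRelEnd_iff_gromov_recognitionR4_relEnd.1 hGR)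

end Summit.SmoothPoincare4.SmoothPoincare4.Theorems
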